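import Literature.NumberTheory.EllipticCurves.BarriosEtAl2025.QuadraticTwistAtTwoConductorProofs
import Literature.NumberTheory.EllipticCurves.QuadraticTwist
import Literature.NumberTheory.EllipticCurves.RootNumberSmulProofs
import Literature.NumberTheory.EllipticCurves.SzpiroLocalDataProofs
import Literature.NumberTheory.DiophantineGeometry.ConductorAdditiveProofs
import HarnessLib

/-!
# A curve with a `2`-SEMISTABLE dyadic twist has `f₂ = 4` (twist by `d ≡ 3 (mod 4)`) or `f₂ = 6` (twist by `d ≡ 2 (mod 4)`); hence off
# `f₂ ∈ {4, 6}` NO dyadic twist is semistable at `2` — the C2 core's twist binder is automatic at `v₂(N) ∈ {2, 3, 5, 7, 8}`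
# (route `ManinLocalTwoThree`, crux C2 `ManinOddAtFour` stmt-BirchSwinnertonDyer-22967; cell bsd-f2-manin, p2 gen 15; route-independent file)

E-blind local law at `2`, the converse reading of the tree's Barrios–Roy–Sahajpal–Tallana–Tobin–Wiersema fact
`BarriosEtAl2025.conductorExponent_quadraticTwist_two_of_le_one` (Thm. 5.1, rows `I₀`/`I_{n>0}`: `f₂(V) ≤ 1 ⟹ f₂(V ⊗ d) = 4` for `d ≡ 3 (4)`,
`= 6` for `d ≡ 2 (4)`): if `f₂(W ⊗ d) ≤ 1` then, since `W ≅ (W ⊗ d) ⊗ d` (`(W ⊗ d) ⊗ d = W ⊗ d²`, Silverman *AEC* X.5 Cor. 5.4),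
`f₂(W) = 4` (`d ≡ 3 (mod 4)`, e.g. `d = −1`) or `f₂(W) = 6` (`d ≡ 2 (mod 4)`, e.g. `d = ±2`).  Consequences for this seat's C2 core
(`maninOddAtFour_of_core`, binder «`2 ≤ f₂(W ⊗ d)` for `d ∈ {−1, 2, −2}`»): the binder is AUTOMATIC whenever `f₂(W) ∉ {4, 6}` — in particular on
the whole stratum `v₂(N) ∈ {5, 7, 8}` and at `v₂(N) ∈ {2, 3}` —, at `f₂ = 4` only `d = −1` can be semistable (`2 ≤ f₂(W ⊗ ±2)`), at `f₂ = 6` only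
`d = ±2` (`2 ≤ f₂(W ⊗ (−1))`).  Equivalently: the TWIST-COVERED classes of C2 (Stevens transport from a `2`-semistable class) live exactly at
`v₂(N) ∈ {4, 6}`.  The `p = 3` twin is `…SemistableTwistTameAtThree` (`27 ∣ N` ⟹ every quadratic twist additive at `3`).
HONEST FRAMING: local structure theorem read off a printed table already in the tree; nothing about BSD, Manin's conjecture or C2 is proved.
No definitions, no named facts, no sorry; no route (Theses) import.
[cite: BarriosEtAl2025, Thm. 5.1, Tables tab:localdata-dodd / tab:localdata-deven, rows I₀ and I_{n>0}, column (f, f^d) (arXiv:2501.03209 pp. 15–16)]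
[cite: SilvermanAEC2009, X.5 Cor. 5.4]
-/

set_option autoImplicit false
-- lint-debt: the directory name repeats the summit name (sibling precedent `ManinLocalTwoThreeQuadraticTwistAtTwoConductorBarriosRows.lean`)
set_option linter.dupNamespace false

noncomputable section

open scoped Classical
open WeierstrassCurve IsDedekindDomain IsDedekindDomain.HeightOneSpectrum Rat.HeightOneSpectrum
  Literature.NumberTheory.DiophantineGeometry Literature.NumberTheory.EllipticCurves
  Literature.NumberTheory.EllipticCurves.BarriosEtAl2025

namespace Summit.BirchSwinnertonDyer.BirchSwinnertonDyer.Theorems.ManinLocalTwoThree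

variable (v : HeightOneSpectrum ℤ)

/-! ## §1 `f₂(W ⊗ d) ≤ 1` forces `f₂(W) ∈ {4, 6}` -/

/-- **`W ≅ (W ⊗ d) ⊗ d`**: `C • W = (W ⊗ d) ⊗ d` for some change of variables over `ℚ` (`(W ⊗ d) ⊗ d = W ⊗ d²`; Silverman *AEC* X.5 Cor. 5.4).
[cite: SilvermanAEC2009, X.5 Cor. 5.4] -/
theorem exists_variableChange_eq_quadraticTwist_quadraticTwist (W : WeierstrassCurve ℚ) {d : ℚ} (hd : d ≠ 0) :
    ∃ C : VariableChange ℚ, C • W = (W.quadraticTwist d).quadraticTwist d := by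
  obtain ⟨C₁, hC₁⟩ := W.exists_variableChange_quadraticTwist_mul_sq 1 d hd
  obtain ⟨C₂, hC₂⟩ := W.exists_variableChange_quadraticTwist_one
  refine ⟨C₁ * C₂, ?_⟩
  rw [mul_smul, hC₂, hC₁, quadraticTwist_quadraticTwist, one_mul, sq]

/-- **A `2`-semistable dyadic twist pins `f₂(W)`**: at the place `v ∋ 2` of `ℤ`, if `f_v(W ⊗ d) ≤ 1` then `f_v(W) = 4` when `d ≡ 3 (mod 4)` and
`f_v(W) = 6` when `d ≡ 2 (mod 4)` — Barrios et al. Thm. 5.1 (rows `I₀`, `I_{n>0}`) applied to `V = W ⊗ d`, with `W ≅ V ⊗ d`.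
[cite: BarriosEtAl2025, Thm. 5.1 (arXiv:2501.03209 pp. 15–16)] [cite: SilvermanAEC2009, X.5 Cor. 5.4] -/
theorem conductorExponent_eq_of_conductorExponent_quadraticTwist_le_one_two (hv : natGenerator v = 2)
    (W : WeierstrassCurve ℚ) [W.IsElliptic] {d : ℤ} (hd0 : d ≠ 0)
    (hf : (haveI := W.isElliptic_quadraticTwist (show (d : ℚ) ≠ 0 by exact_mod_cast hd0);
      (W.quadraticTwist (d : ℚ)).conductorExponent v) ≤ 1) :
    (d % 4 = 3 → W.conductorExponent v = 4) ∧ (d % 4 = 2 → W.conductorExponent v = 6) := by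
  have hd0' : (d : ℚ) ≠ 0 := by exact_mod_cast hd0
  haveI := W.isElliptic_quadraticTwist hd0'
  haveI := (W.quadraticTwist (d : ℚ)).isElliptic_quadraticTwist hd0'
  obtain ⟨C, hC⟩ := exists_variableChange_eq_quadraticTwist_quadraticTwist W hd0'
  have hfW : W.conductorExponent v = ((W.quadraticTwist (d : ℚ)).quadraticTwist (d : ℚ)).conductorExponent v := by
    rw [← hC, conductorExponent_smul']
  have key := conductorExponent_quadraticTwist_two_of_le_one_holds (W.quadraticTwist (d : ℚ)) v hv hf d
  exact ⟨fun h3 ↦ hfW.trans (key.1 h3), fun h2 ↦ hfW.trans (key.2 h2)⟩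

/-! ## §2 Off `f₂ ∈ {4, 6}` no dyadic twist is semistable at `2`; at `f₂ = 4` only `d = −1`, at `f₂ = 6` only `d = ±2` -/

/-- **The C2 core's twist binder is automatic off `f₂ ∈ {4, 6}`**: if `f₂(W) ≠ 4` and `f₂(W) ≠ 6`, then `2 ≤ f₂(W ⊗ d)` for each `d ∈ {−1, 2, −2}`
(every dyadic twist is additive at `2`).  [cite: BarriosEtAl2025, Thm. 5.1 (arXiv:2501.03209 pp. 15–16)] -/
theorem two_le_conductorExponent_dyadicTwist_of_ne_four_of_ne_six (hv : natGenerator v = 2)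
    (W : WeierstrassCurve ℚ) [W.IsElliptic] (h4 : W.conductorExponent v ≠ 4) (h6 : W.conductorExponent v ≠ 6)
    {d : ℤ} (hd : d = -1 ∨ d = 2 ∨ d = -2) :
    2 ≤ (haveI := W.isElliptic_quadraticTwist (show (d : ℚ) ≠ 0 by exact_mod_cast (show d ≠ 0 by omega));
      (W.quadraticTwist (d : ℚ)).conductorExponent v) := by
  have hd0 : d ≠ 0 := by omega
  haveI := W.isElliptic_quadraticTwist (show (d : ℚ) ≠ 0 by exact_mod_cast hd0)
  by_contra hlt
  have key := conductorExponent_eq_of_conductorExponent_quadraticTwist_le_one_two v hv W hd0 (by omega)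
  rcases hd with rfl | rfl | rfl
  · exact h4 (key.1 (by decide))
  · exact h6 (key.2 (by decide))
  · exact h6 (key.2 (by decide))

/-- **At `f₂(W) = 4` the twists by `±2` are additive at `2`** (only `d = −1` can be semistable).
[cite: BarriosEtAl2025, Thm. 5.1 (arXiv:2501.03209 pp. 15–16)] -/
theorem two_le_conductorExponent_quadraticTwist_two_of_eq_four (hv : natGenerator v = 2)
    (W : WeierstrassCurve ℚ) [W.IsElliptic] (h4 : W.conductorExponent v = 4) {d : ℤ} (hd : d = 2 ∨ d = -2) :
    2 ≤ (haveI := W.isElliptic_quadraticTwist (show (d : ℚ) ≠ 0 by exact_mod_cast (show d ≠ 0 by omega));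
      (W.quadraticTwist (d : ℚ)).conductorExponent v) := by
  have hd0 : d ≠ 0 := by omega
  haveI := W.isElliptic_quadraticTwist (show (d : ℚ) ≠ 0 by exact_mod_cast hd0)
  by_contra hlt
  have key := (conductorExponent_eq_of_conductorExponent_quadraticTwist_le_one_two v hv W hd0 (by omega)).2 (by omega)
  omega

/-- **At `f₂(W) = 6` the twist by `−1` is additive at `2`** (only `d = ±2` can be semistable).
[cite: BarriosEtAl2025, Thm. 5.1 (arXiv:2501.03209 pp. 15–16)] -/
theorem two_le_conductorExponent_quadraticTwist_negOne_of_eq_six (hv : natGenerator v = 2)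
    (W : WeierstrassCurve ℚ) [W.IsElliptic] (h6 : W.conductorExponent v = 6) :
    2 ≤ (haveI := W.isElliptic_quadraticTwist (show ((-1 : ℤ) : ℚ) ≠ 0 by norm_num);
      (W.quadraticTwist ((-1 : ℤ) : ℚ)).conductorExponent v) := by
  haveI := W.isElliptic_quadraticTwist (show ((-1 : ℤ) : ℚ) ≠ 0 by norm_num)
  by_contra hlt
  have key := (conductorExponent_eq_of_conductorExponent_quadraticTwist_le_one_two v hv W (d := -1) (by norm_num) (by omega)).1 (by decide)
  omega

/-! ## §3 Conductor-norm currency: `v₂(N) ∉ {4, 6}` -/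

/-- **`v₂(N(W)) ∉ {4, 6}` ⟹ every dyadic twist of `W` is additive at `2`** (`4 ∣ N(W ⊗ d)` for `d ∈ {−1, 2, −2}`): the twist-covered classes of
C2 live exactly at `v₂(N) ∈ {4, 6}`.  [cite: BarriosEtAl2025, Thm. 5.1 (arXiv:2501.03209 pp. 15–16)] -/
theorem four_dvd_conductorNorm_dyadicTwist_of_factorization_ne (W : WeierstrassCurve ℚ) [W.IsElliptic]
    (h4 : (W.conductorNorm ℤ).factorization 2 ≠ 4) (h6 : (W.conductorNorm ℤ).factorization 2 ≠ 6)
    {d : ℤ} (hd : d = -1 ∨ d = 2 ∨ d = -2) :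
    (haveI := W.isElliptic_quadraticTwist (show (d : ℚ) ≠ 0 by exact_mod_cast (show d ≠ 0 by omega));
      2 ^ 2 ∣ (W.quadraticTwist (d : ℚ)).conductorNorm ℤ) := by
  haveI := W.isElliptic_quadraticTwist (show (d : ℚ) ≠ 0 by exact_mod_cast (show d ≠ 0 by omega))
  set v : HeightOneSpectrum ℤ := (primesEquiv (R := ℤ)).symm ⟨2, Nat.prime_two⟩ with hvdef
  have hv : natGenerator v = 2 := congrArg Subtype.val ((primesEquiv (R := ℤ)).apply_symm_apply ⟨2, Nat.prime_two⟩)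
  have hfacW : (W.conductorNorm ℤ).factorization 2 = W.conductorExponent v := factorization_conductorNorm_primesEquiv_symm W ⟨2, Nat.prime_two⟩
  have hfacT : ((W.quadraticTwist (d : ℚ)).conductorNorm ℤ).factorization 2 = (W.quadraticTwist (d : ℚ)).conductorExponent v :=
    factorization_conductorNorm_primesEquiv_symm _ ⟨2, Nat.prime_two⟩
  have h2 := two_le_conductorExponent_dyadicTwist_of_ne_four_of_ne_six v hv W (by rwa [← hfacW]) (by rwa [← hfacW]) hd
  rw [Nat.prime_two.pow_dvd_iff_le_factorization ((W.quadraticTwist (d : ℚ)).conductorNorm_pos_holds).ne', hfacT]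
  exact h2

end Summit.BirchSwinnertonDyer.BirchSwinnertonDyer.Theorems.ManinLocalTwoThree

end
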